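import Summits.Ventures.PercRepro.ProfileGapMonoHardThree

/-!
# PercRepro — THE HARD RULE IN ROW FORM: `C025` FROM THE CO-RANK-`q` ROW ON THE HARD CLASS ALONE (p10, gen 8)

`c025_of_hardRuleQ''` asks for a gap-monotone POINT in every simple matroid with no `q`-generic point (`q ≥ 3`,
`q < u < ρ(E)`).  The induction only uses such a point to pass from `N` to `N ∖ z`; what it really needs is the
co-rank-`q` row of `N` itself.  `HardRowQ''` asks for exactly that — the weakest hypothesis the induction can take:
a proof of the row on the hard class by ANY means (a gap-monotone point, a direct count, a duality argument, …)
closes `C025`.  In particular `hardRowQ''_of_hardRuleQ''` shows it is implied by the point form, and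
`profileIneqMinusQ_of_hardRowQ''_aux` is the induction of ProfileGapMonoHardThree with the rule replaced by the row.

* `HardRowQ''`, `profileIneqMinusQ_of_hardRowQ''_aux`, **`profileIneqMinusQ_of_hardRowQ''`**,
  `profileIneq_of_hardRowQ''`, `c025Profile_of_hardRowQ''`, **`c025_of_hardRowQ''`**, `hardRowQ''_of_hardRuleQ''`.
-/

open scoped Matroid

namespace PercRepro.Cogirth

open Finset ThmH Skew Shadow Profile

variable {α : Type} [DecidableEq α] {M : Matroid α} [M.Finite]

/-- **The hard rule in row form**: the co-rank-`q` row itself on every simple matroid on at least `u + q + 1`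
elements of rank `> u` in which every point lies on a cocircuit of rank `≤ q`, for `3 ≤ q < u`.
A CONJECTURE (data only); not asserted here. -/
def HardRowQ'' (α : Type) [DecidableEq α] : Prop :=
  ∀ (q u : ℕ), 3 ≤ q → q < u → ∀ (N : Matroid α) [N.Finite], Simple' N → u + q + 1 ≤ (gr N).card →
    u + 1 ≤ rk N (gr N) → (∀ z ∈ gr N, ¬ GenericQ N z q) → ProfileIneqMinusQ N q u

/-- The co-rank-`q` row of every finite matroid from the row form of the hard rule: strong induction on `#E`, the
rows `q ≤ 2`, loops, parallel pairs, generic points and the levels `u ≥ ρ(E)` as in ProfileGapMonoHardThree. -/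
theorem profileIneqMinusQ_of_hardRowQ''_aux (hrow : HardRowQ'' α) (n : ℕ) :
    ∀ (K : Matroid α) [K.Finite], (gr K).card = n → ∀ q u : ℕ, q < u → ProfileIneqMinusQ K q u := by
  induction n using Nat.strong_induction_on with
  | _ n ih =>
    intro K _ hn q u hqu
    rcases Nat.lt_or_ge q 3 with hq3 | hq3
    · interval_cases q
      · exact profileIneqMinusQ_zero K u
      · exact profileIneqMinusQ_one_all K (by omega)
      · exact profileIneqMinusQ_two_all K u (by omega)
    have hq : 0 < q := by omega
    by_cases hsmall : (gr K).card ≤ u + q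
    · exact profileIneqMinusQ_of_card_le hqu.le hsmall
    push Not at hsmall
    have hIH : ∀ z ∈ gr K, ProfileIneqMinusQ (K ＼ ({z} : Set α)) q u := by
      intro z hz
      have hcard : (gr (K ＼ ({z} : Set α))).card = n - 1 := by
        rw [gr_delete', card_erase_of_mem hz, hn]
      have hlt : n - 1 < n := by
        have := card_pos.2 ⟨z, hz⟩
        omega
      exact ih (n - 1) hlt _ hcard q u hqu
    -- a loop
    by_cases hl : ∃ ℓ ∈ gr K, rk K {ℓ} = 0
    · obtain ⟨ℓ, hℓ, h0⟩ := hl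
      exact profileIneqMinusQ_of_gapMonoQ (gapMonoQ_of_loop hℓ h0 (hIH ℓ hℓ)) (hIH ℓ hℓ)
    push Not at hl
    have h1 : ∀ x ∈ gr K, rk K {x} = 1 := by
      intro x hx
      have := rk_le_card (M := K) ({x} : Finset α)
      rw [card_singleton] at this
      have := hl x hx
      omega
    -- a parallel pair
    by_cases hp : ∃ z ∈ gr K, ∃ z' ∈ gr K, z ≠ z' ∧ rk K {z, z'} = 1
    · obtain ⟨z, hz, z', hz', hzz', hpar⟩ := hp
      have hcard : (gr ((K ＼ ({z} : Set α)) ／ ({z'} : Set α))).card = n - 2 := by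
        rw [gr_contract', gr_delete', card_erase_of_mem (mem_erase.2 ⟨Ne.symm hzz', hz'⟩), card_erase_of_mem hz, hn]
        omega
      have hlt : n - 2 < n := by
        have := card_pos.2 ⟨z, hz⟩
        omega
      have hdel := ih (n - 2) hlt _ hcard (q - 1) (u - 1) (by omega)
      exact profileIneqMinusQ_of_gapMonoQ
        (gapMonoQ_of_parallel hz hz' hzz' (h1 z hz) (h1 z' hz') hpar hq hqu hdel) (hIH z hz)
    push Not at hp
    have h2 : ∀ x ∈ gr K, ∀ y ∈ gr K, x ≠ y → rk K {x, y} = 2 := by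
      intro x hx y hy hxy
      have hle := rk_le_card (M := K) ({x, y} : Finset α)
      rw [card_pair hxy] at hle
      have hge : rk K {x} ≤ rk K {x, y} := rk_mono_sub (by simp)
      have hne := hp x hx y hy hxy
      have := h1 x hx
      omega
    have hs : Simple' K := simple'_of_rk_one_two h1 h2
    -- a generic point
    by_cases hgen : ∃ z ∈ gr K, GenericQ K z q
    · obtain ⟨z, hz, hg⟩ := hgen
      have hzI : K.Indep {z} := by
        have h := indep_of_rk_eq_card (M := K) (X := {z}) (by rw [card_singleton]; exact h1 z hz)
        rwa [coe_singleton] at h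
      have hcard : (gr (K ／ ({z} : Set α))).card = n - 1 := by
        rw [gr_contract', card_erase_of_mem hz, hn]
      have hlt : n - 1 < n := by
        have := card_pos.2 ⟨z, hz⟩
        omega
      have hdel := ih (n - 1) hlt _ hcard (q - 1) (u - 1) (by omega)
      exact profileIneqMinusQ_of_gapMonoQ (gapMonoQ_of_generic' hzI hq hqu hg hdel) (hIH z hz)
    push Not at hgen
    -- the levels `u ≥ ρ(E)`
    by_cases hR1 : rk K (gr K) < u
    · exact profileIneqMinusQ_of_rk_lt hR1
    by_cases hR2 : rk K (gr K) = u
    · obtain ⟨z, hz⟩ : (gr K).Nonempty := card_pos.1 (by omega)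
      have htop := gapMonoQ_top (M := K) (q := q) (by omega) z hz
      rw [hR2] at htop
      exact profileIneqMinusQ_of_gapMonoQ htop (hIH z hz)
    -- the row on the hard class
    exact hrow q u hq3 hqu K hs (by omega) (by omega) hgen

/-- The co-rank-`q` row of every finite matroid from the row form of the hard rule. -/
theorem profileIneqMinusQ_of_hardRowQ'' (hrow : HardRowQ'' α) (K : Matroid α) [K.Finite] {q u : ℕ}
    (hqu : q < u) : ProfileIneqMinusQ K q u :=
  profileIneqMinusQ_of_hardRowQ''_aux hrow _ K rfl q u hqu

/-- The plain row from the row form of the hard rule. -/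
theorem profileIneq_of_hardRowQ'' (hrow : HardRowQ'' α) (K : Matroid α) [K.Finite] {q u : ℕ}
    (hqu : q < u) : ProfileIneq K q u :=
  profileIneq_of_minusQ hqu.le (profileIneqMinusQ_of_hardRowQ'' hrow K hqu)

/-- The point form implies the row form: a gap-monotone point plus the row of the deletion (a theorem on every
finite matroid under the point form). -/
theorem hardRowQ''_of_hardRuleQ'' (hrule : HardRuleQ'' α) : HardRowQ'' α := by
  intro q u hq3 hqu N _ hs hn hR hgen
  obtain ⟨z, hz, hgm⟩ := hrule q u hq3 hqu N hs hn hR hgen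
  exact profileIneqMinusQ_of_gapMonoQ hgm (profileIneqMinusQ_of_hardRuleQ'' hrule _ hqu)

end PercRepro.Cogirth

namespace PercRepro

/-- **`C025Profile` FROM THE ROW FORM OF THE HARD RULE.** -/
theorem c025Profile_of_hardRowQ'' (h : ∀ (α : Type) [DecidableEq α], Cogirth.HardRowQ'' α) : C025Profile := by
  intro α _ M _ q u hqu
  exact Cogirth.profileIneq_of_hardRowQ'' (h α) M hqu

/-- **`C025` FROM THE ROW FORM OF THE HARD RULE**: the co-rank-`q` row on the simple matroids in which every point
lies on a cocircuit of rank `≤ q`, for `q ≥ 3` and `q < u < ρ(E)` — by any means. -/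
theorem c025_of_hardRowQ'' (h : ∀ (α : Type) [DecidableEq α], Cogirth.HardRowQ'' α) : C025 :=
  c025_of_profile (c025Profile_of_hardRowQ'' h)

end PercRepro
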